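import Literature.NumberTheory.Automorphic.Liu2021.Def411WeilCarriersIrreducibleOrZeroOfLocal
import Literature.NumberTheory.Automorphic.Liu2021.Def411WeilCarriersAtChiSplittingOmega
import Literature.NumberTheory.Automorphic.Liu2021.LemD1SplitPlaceOfFacts
import Literature.NumberTheory.Automorphic.Liu2021.SplitPlaceOscillatorModelProofs
import Literature.NumberTheory.Automorphic.Zelevinsky1980.UnitaryCharacterInductionIrreducible
import Literature.RepresentationTheory.MoeglinVignerasWaldspurger1987.RankOneThetaLiftIrreducibleProofs
import Literature.RepresentationTheory.MoeglinVignerasWaldspurger1987.RankOneThetaLiftAdmissibleProofs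
import Literature.NumberTheory.GelbartRogawski1991.UndoubledSplittingsUnitary
import HarnessLib

/-!
# [Liu2021, Def. 4.11]'s carrier `ω(μ, ε, χ)` at a line `⟨a⟩` is IRREDUCIBLE OR ZERO at EVERY rank `n ≥ 2` — in particular for
# the rank-2 carrier `ω⋆` of App. D (the d6 line's registered carrier), where ZERO does occur

Topic `NumberTheory/Automorphic/Liu2021`; namespaces `Literature.NumberTheory.Automorphic.Liu2021.Def411WeilCarriers` (§3 local inputs, §4 head).  KERNEL ONLY: theorems, no definition, no named
fact, no `sorry`.  Nothing of [Liu2021] or [MoeglinVignerasWaldspurger1987] is asserted: every local input is a tree theorem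
(`mvw_IV4_rankOne_irreducibleOrZero_holds`, `mvw_IV4_rankOne_admissible_holds`,
`splitPlace_chiCoinv_iso_parabolicIndGL_of_isIrreducible parabolicIndGL_detChar_unitary_isIrreducible_holds`).

WHY.  The tree's irreducibility of `ω(μ, ε, χ)` (`Def411WeilCarriers.rho(AtLine)_isIrreducible_of_lemD1AsPrinted'`,
★) is a `3 ≤ n` statement: it feeds [Liu2021, App. D Lem. D.1 (1)]'s non-vanishing «`ω(μ_v, ε_v, χ_v)` is zero iff `E_v` is a
field, `V_v` is anisotropic (in particular `n = 2`), and `χ̌_v = μ_v²`» (l. 5229) through `isotropyRankThree`.  At `n = 2` — the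
unitary Shimura CURVE of App. D, `V` of rank 2, signature `(1,1)` at `τ₁` and definite elsewhere (l. 5355), the carrier
`ω⋆ = rhoVAtLine … 2 … (hsChiGS …)` of the cell's `thmD6OneCurveCUF` — anisotropic finite places exist (parity of
`∏_v η_v(−det V) = 1`), the local factor there vanishes for one character of `E_v¹`, and `ω(μ, ε, χ) = ⊗'_v ω_v` IS ZERO for
those `χ`: Mathlib's `Representation.IsIrreducible` (which entails `Nontrivial`) FAILS as a statement over all `χ`.  What print
uses at `n = 2` (Thm. D.6 (1) presupposes `π^∞ ≅ ω(μ, ε, χ)` irreducible) and what the consumers need (`omegaHom` out of a zero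
carrier is `{0}`) is Liu's own reading «irreducible OR ZERO» (`Def411AsPrinted.IsIrreducibleOrZero`, Lem. D.1 first sentence
+ (1)).  This file proves it, rank-free:

* (prequel `Def411WeilCarriersIrreducibleOrZeroOfLocal.lean`: `WeilCoinv.omega_center_isIrreducibleOrZero_of_local` — every local
  central quotient irreducible-or-zero and admissible + survival ⇒ the global central quotient is irreducible or zero; glue.)
* §3 the LOCAL inputs at every finite place, `2 ≤ n`: `isIrreducibleOrZero_and_isAdmissible_local_of_isField` (non-split,
  [MVW, Chap. 3 IV.4 1a) 2a)] ★) and `splitPlace_irreducibleOrZero_and_isAdmissible_of_two_le` (split, the `GL_n` model ★ +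
  [Zelevinsky1980, Thm. 4.2] ★, `2 ≤ n` — the tree's `splitPlace_model_consequences_of_facts` is the `3 ≤ n` instance).
* §4 HEAD `isIrreducibleOrZero_rhoVAtLine_chiSplittingLine` — for a CM field `L`, ANY rank `N'` with `2 ≤ n'`, real diagonal
  `dV₁`, THE χ-attached splitting `chiSplittingLine θ` of a unitary splitting character `θ`, any line `⟨a⟩` and `χ ∈ Chi`:
  `IsIrreducibleOrZero (rhoVAtLine (Fp L) L c̄ N' e₁ (diagonal dV₁) … (fun b => isCompatible_chiSplittingLine …) a χ)` — via ★
  `rhoVAtLine_chiSplittingLine_areIsomorphicRep_omega_center … (borelPlaceMeasure L) (cmFinLocalFamily …)` (twist-free), §2 at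
  `𝓢_θ = congrW … (undoubledSplittings …)`, §3 with ★ `isL2Isometric_omegaLoc_congrW_undoubledSplittings_cmFinLocalFamily`, ★
  `survival_atLine`; and `…_comp_of_surjective` (any surjective change of group, e.g. `(finAdelicCongr … g⋆ …).symm`).
  The d6 socket `IsIrreducibleOrZero ω⋆` is the instance `L := F`, `N' := 2`, `e₁ := finProdFinEquiv`, `dV₁ := dJ`,
  `θ := toHeckeCharacter F (galConj c̄ μ)`, `a := r.toFun ε` (cell `hodgecm-mathlib`, crux 24832, input (i) of the S2′ node).

HC_CM is proved only modulo the 7 printed citations (`hDel`, `h21`, `hLiu418`, `h411`, `h413`, `hD3`, `hD1''`) until rung 0 closes;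
this file discharges none of them and no interface fact.

## References
* [Liu2021] Y. Liu, *Fourier–Jacobi cycles and arithmetic relative trace formula*, Camb. J. Math. 9 (2021) = arXiv:2102.11518:
  Def. 4.11 (l. 2090–2096), App. D §D.1 Steps 1–3 (l. 5217–5221), Lem. D.1 first sentence + (1) (l. 5226–5229), §D.3 (l. 5355),
  Thm. D.6 (1) (l. 5436–5443).
* [MoeglinVignerasWaldspurger1987] C. Mœglin, M.-F. Vignéras, J.-L. Waldspurger, LNM 1291, Chap. 3 IV.4 Thm principal 1a), 2a).
* [Zelevinsky1980] A. Zelevinsky, Ann. Sci. ÉNS 13 (1980), Thm. 4.2.  [GelbartRogawski1990] S. Gelbart, J. Rogawski, §2.6.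
* [Flath1979] D. Flath, PSPM 33 (1979) part 1, §2, Theorem 2 / Example 2.
* [GelbartRogawski1991] S. Gelbart, J. Rogawski, Invent. Math. 105 (1991), §3.1 Prop. 3.1.1 p. 455, Remark p. 457.
-/

set_option autoImplicit false

noncomputable section

open scoped Matrix Kronecker TensorProduct Classical RestrictedProduct
open NumberField NumberField.mixedEmbedding IsDedekindDomain Filter Set
open _root_.MeasureTheory
open Literature.NumberTheory Literature.NumberTheory.Automorphic Literature.NumberTheory.Automorphic.UnitaryGroup
open Literature.NumberTheory.GelbartRogawski1991 Literature.NumberTheory.GelbartRogawski1991.UnitaryDualPair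
open Literature.NumberTheory.GelbartRogawski1991.UnitaryDualPair.WeilCoinv
open Literature.NumberTheory.GelbartRogawski1991.GRConstruction
open Literature.NumberTheory.Weil1964 Literature.RepresentationTheory
open Literature.RepresentationTheory.HeisenbergGroup
open Literature.GroupTheory.RestrictedProductCharacter
open Literature.RepresentationTheory.MoeglinVignerasWaldspurger1987
open Literature.NumberTheory.GaloisRepresentations Literature.RepresentationTheory.HarrisKudlaSweet1996
open Literature.NumberTheory.Automorphic.Liu2021 Literature.NumberTheory.Automorphic.Liu2021.Def411WeilCarriersDoubling

/-! ## §3 The LOCAL inputs at every finite place, rank `n ≥ 2` -/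

namespace Literature.NumberTheory.Automorphic.Liu2021.Def411WeilCarriers

open Literature.NumberTheory.GelbartRogawski1991.UnitaryDualPair.LocalSplitting (iota LocalMp localSchrodinger)

section Local

variable (F E : Type) [Field F] [NumberField F] [Field E] [NumberField E] [Algebra F E]
variable (c : E ≃ₐ[F] E) (N : ℕ) {n : ℕ} (e : Fin N × Fin 1 ≃ Fin n)
variable (JV : Matrix (Fin N) (Fin N) E) {TV : Matrix (Fin N) (Fin N) F}
variable [Algebra.IsQuadraticExtension F E] {δ : E} (hcδ : c δ = -δ) (hδ : δ ≠ 0) {d : F}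
  (hd : δ * δ = algebraMap F E d) (hV : TV.IsSymm) (hVd : IsUnit TV.det) (hJV : JV = TV.map (algebraMap F E))
variable (a : Fˣ)
  (𝓢 : LocalSplitting.FinLocalSplittings F E c n hcδ hδ hd (gram F e TV (TW F a)) (isSymm_gram F e hV (isSymm_TW F a))
    (reindex_kronecker_eq_gram_map F E e hJV (JW_eq F E a)))
  (χ₁ : UnitaryGroup.finAdelicOne F E c →* ℂˣ) (hχ₁n : ∀ u, ‖((χ₁ u : ℂˣ) : ℂ)‖ = 1) (hχ₁c : Continuous χ₁)
  (v : HeightOneSpectrum (𝓞 F))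

include hVd hχ₁n hχ₁c in
/-- **[Liu2021, Lem. D.1, first sentence] at a NON-SPLIT place, any rank**: the local central `χ_{1,v}`-quotient of
`ω_v = 𝓢.omegaLoc v` with its `U(J_V ⊗ (a))(F_v)`-action is irreducible-or-zero and admissible — [MoeglinVignerasWaldspurger1987,
Chap. 3 IV.4 Thm principal 1a), 2a)] for the pair `(U(⟨a⟩), U(J_V ⊗ (a)))` at the smooth section `𝓢.s v` (the tree's PROVED
`mvw_IV4_rankOne_irreducibleOrZero_holds`, `mvw_IV4_rankOne_admissible_holds`; `𝓢.omegaLoc v = toRep ∘ 𝓢.s v` by `rfl`).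
[cite: Liu2021, App. D Lemma D.1 (l. 5227)] [cite: MoeglinVignerasWaldspurger1987, Chap. 3 IV.4 Thm principal 1a), 2a)] -/
theorem isIrreducibleOrZero_and_isAdmissible_local_of_isField (hf : IsField (LocalRing E v)) :
    IsIrreducibleOrZero (TwistedCoinv.rep
        (ρW := show Representation ℂ (localPi E c 1 (JW F E a) v) (SchwartzBruhat (Fin n → v.adicCompletion F)) from
          (𝓢.omegaLoc v).comp (localCenter E c n (Matrix.reindex e e (JV ⊗ₖ JW F E a)) (JW F E a) (JW_apply_ne_zero F E a) v))
        (localCharOfCenter F E c (JW F E a) (JW_apply_ne_zero F E a) χ₁ v) (𝓢.omegaLoc v)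
        (fun g z => (show Commute g (localCenter E c n (Matrix.reindex e e (JV ⊗ₖ JW F E a)) (JW F E a) (JW_apply_ne_zero F E a) v z) from
        localCenter_comm E c n (Matrix.reindex e e (JV ⊗ₖ JW F E a)) (JW F E a) (JW_apply_ne_zero F E a) v z g).map (𝓢.omegaLoc v))) ∧
      (TwistedCoinv.rep
        (ρW := show Representation ℂ (localPi E c 1 (JW F E a) v) (SchwartzBruhat (Fin n → v.adicCompletion F)) from
          (𝓢.omegaLoc v).comp (localCenter E c n (Matrix.reindex e e (JV ⊗ₖ JW F E a)) (JW F E a) (JW_apply_ne_zero F E a) v))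
        (localCharOfCenter F E c (JW F E a) (JW_apply_ne_zero F E a) χ₁ v) (𝓢.omegaLoc v)
        (fun g z => (show Commute g (localCenter E c n (Matrix.reindex e e (JV ⊗ₖ JW F E a)) (JW F E a) (JW_apply_ne_zero F E a) v z) from
        localCenter_comm E c n (Matrix.reindex e e (JV ⊗ₖ JW F E a)) (JW F E a) (JW_apply_ne_zero F E a) v z g).map (𝓢.omegaLoc v))).IsAdmissible :=
  ⟨mvw_IV4_rankOne_irreducibleOrZero_holds F E c n δ hcδ hδ d hd _ _ (isUnit_det_gram F e hVd (isUnit_det_TW F a)) _ _ v hf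
      (𝓢.s v) (𝓢.proj_s v) (𝓢.smooth v) (JW F E a) (JW_apply_ne_zero F E a) _
      (norm_localCharOfCenter F E c (JW F E a) (JW_apply_ne_zero F E a) hχ₁n v)
      (continuous_coe_localCharOfCenter F E c (JW F E a) (JW_apply_ne_zero F E a) hχ₁c v),
    mvw_IV4_rankOne_admissible_holds F E c n δ hcδ hδ d hd _ _ (isUnit_det_gram F e hVd (isUnit_det_TW F a)) _ _ v hf
      (𝓢.s v) (𝓢.proj_s v) (𝓢.smooth v) (JW F E a) (JW_apply_ne_zero F E a) _
      (norm_localCharOfCenter F E c (JW F E a) (JW_apply_ne_zero F E a) hχ₁n v)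
      (continuous_coe_localCharOfCenter F E c (JW F E a) (JW_apply_ne_zero F E a) hχ₁c v)⟩

omit [NumberField F] [NumberField E] [Algebra.IsQuadraticExtension F E] in
/-- `χ′ ν^k` is continuous (`ℂ`-valued) for continuous `ν, χ′ : Kˣ → ℂˣ`. [folklore] -/
private theorem continuous_coe_mul_zpow' {K : Type*} [CommGroup K] [TopologicalSpace K] (ν χ' : K →* ℂˣ)
    (hνc : Continuous fun x => ((ν x : ℂˣ) : ℂ)) (hχ'c : Continuous fun x => ((χ' x : ℂˣ) : ℂ)) (k : ℤ) :
    Continuous fun x => (((χ' * ν ^ k) x : ℂˣ) : ℂ) := by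
  have h : (fun x => (((χ' * ν ^ k) x : ℂˣ) : ℂ)) = fun x => ((χ' x : ℂˣ) : ℂ) * ((ν x : ℂˣ) : ℂ) ^ k := by
    funext x
    rw [MonoidHom.mul_apply, MonoidHom.zpow_apply, Units.val_mul, Units.val_zpow_eq_zpow_val]
  rw [h]
  exact hχ'c.mul (hνc.zpow₀ k fun x => Or.inl (Units.ne_zero _))

omit [NumberField F] [NumberField E] [Algebra.IsQuadraticExtension F E] in
/-- `χ′ ν^k` is unitary for unitary `ν, χ′`. [folklore] -/
private theorem norm_coe_mul_zpow' {K : Type*} [CommGroup K] (ν χ' : K →* ℂˣ) (hνu : ∀ x, ‖((ν x : ℂˣ) : ℂ)‖ = 1)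
    (hχ'u : ∀ x, ‖((χ' x : ℂˣ) : ℂ)‖ = 1) (k : ℤ) (x : K) : ‖(((χ' * ν ^ k) x : ℂˣ) : ℂ)‖ = 1 := by
  rw [MonoidHom.mul_apply, MonoidHom.zpow_apply, Units.val_mul, Units.val_zpow_eq_zpow_val, norm_mul, norm_zpow,
    hχ'u, hνu, one_zpow, one_mul]

include hVd hχ₁n hχ₁c in
/-- **[Liu2021, App. D, proof of Lem. D.1, l. 5253] at a SPLIT place, rank `n ≥ 2`**: «We identify `U(V)` with `GL_n(F)` …
`ω(μ, ε, χ)` is isomorphic to the unitary induction from `P_{n−1,1}(F)` to `GL_n(F)` of the (unitary) character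
`(ν∘det) ⊠ χν^{1−n}`» — for a family `𝓢` whose `ω_v` is `L²(μ′ⁿ)`-isometric, the local central `χ_{1,v}`-quotient is
irreducible-or-zero, admissible and NON-ZERO.  The tree's `splitPlace_model_consequences_of_facts` VERBATIM with its idle
`3 ≤ n` weakened to the `2 ≤ n` the model fact `splitPlace_chiCoinv_iso_parabolicIndGL` actually takes, both interface facts
being tree theorems (`splitPlace_chiCoinv_iso_parabolicIndGL_of_isIrreducible`, [Zelevinsky1980, Thm. 4.2]
`parabolicIndGL_detChar_unitary_isIrreducible_holds`); admissibility of the induced representation by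
`SplitPlace.isAdmissible_trivial_twist_maxParabolicLeviChar`, transport back by `SplitPlace.adjectives_of_areIsomorphicRep_comp_symm`.
[cite: Liu2021, App. D, proof of Lemma D.1 (first paragraph), p. 126] [cite: Zelevinsky1980, Thm. 4.2] -/
theorem splitPlace_irreducibleOrZero_and_isAdmissible_of_two_le (hn : 2 ≤ n)
    [MeasurableSpace (v.adicCompletion F)] [BorelSpace (v.adicCompletion F)]
    (μ' : Measure (v.adicCompletion F)) [μ'.IsAddHaarMeasure] (hsplit : ¬ IsField (LocalRing E v))
    (hL2 : (𝓢.omegaLoc v).IsL2Isometric (Measure.pi fun _ : Fin n => μ')) :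
    IsIrreducibleOrZero (TwistedCoinv.rep
        (ρW := show Representation ℂ (localPi E c 1 (JW F E a) v) (SchwartzBruhat (Fin n → v.adicCompletion F)) from
          (𝓢.omegaLoc v).comp (localCenter E c n (Matrix.reindex e e (JV ⊗ₖ JW F E a)) (JW F E a) (JW_apply_ne_zero F E a) v))
        (localCharOfCenter F E c (JW F E a) (JW_apply_ne_zero F E a) χ₁ v) (𝓢.omegaLoc v)
        (fun g z => (show Commute g (localCenter E c n (Matrix.reindex e e (JV ⊗ₖ JW F E a)) (JW F E a) (JW_apply_ne_zero F E a) v z) from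
        localCenter_comm E c n (Matrix.reindex e e (JV ⊗ₖ JW F E a)) (JW F E a) (JW_apply_ne_zero F E a) v z g).map (𝓢.omegaLoc v))) ∧
      (TwistedCoinv.rep
        (ρW := show Representation ℂ (localPi E c 1 (JW F E a) v) (SchwartzBruhat (Fin n → v.adicCompletion F)) from
          (𝓢.omegaLoc v).comp (localCenter E c n (Matrix.reindex e e (JV ⊗ₖ JW F E a)) (JW F E a) (JW_apply_ne_zero F E a) v))
        (localCharOfCenter F E c (JW F E a) (JW_apply_ne_zero F E a) χ₁ v) (𝓢.omegaLoc v)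
        (fun g z => (show Commute g (localCenter E c n (Matrix.reindex e e (JV ⊗ₖ JW F E a)) (JW F E a) (JW_apply_ne_zero F E a) v z) from
        localCenter_comm E c n (Matrix.reindex e e (JV ⊗ₖ JW F E a)) (JW F E a) (JW_apply_ne_zero F E a) v z g).map (𝓢.omegaLoc v))).IsAdmissible ∧
      Nontrivial (TwistedCoinv.Coinv
        (show Representation ℂ (localPi E c 1 (JW F E a) v) (SchwartzBruhat (Fin n → v.adicCompletion F)) from
          (𝓢.omegaLoc v).comp (localCenter E c n (Matrix.reindex e e (JV ⊗ₖ JW F E a)) (JW F E a) (JW_apply_ne_zero F E a) v))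
        (localCharOfCenter F E c (JW F E a) (JW_apply_ne_zero F E a) χ₁ v)) := by
  haveI := secondCountableTopology_adicCompletion F v
  haveI : (Measure.pi fun _ : Fin n => μ').IsAddHaarMeasure := Measure.pi.isAddHaarMeasure _
  -- `J = J_V ⊗ (a)` is hermitian with non-zero determinant; `c ≠ 1`
  have hJh : ((Matrix.reindex e e (JV ⊗ₖ JW F E a)).map c)ᵀ = Matrix.reindex e e (JV ⊗ₖ JW F E a) :=
    reindex_kronecker_JW_hermitian F E c N e JV hV hJV a
  have hJu : IsUnit (Matrix.reindex e e (JV ⊗ₖ JW F E a)) :=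
    (Matrix.isUnit_iff_isUnit_det _).2 (isUnit_iff_ne_zero.2 (det_reindex_kronecker_JW_ne_zero F E N e JV hVd hJV a))
  have hc1 : c ≠ 1 := UnitaryGroup.algEquiv_ne_one_of_apply_eq_neg F E c hcδ hδ
  -- (i) a place `w ∣ v` moved by `c`; (ii) `J` invertible at `w`
  obtain ⟨w, hw⟩ := SplitPlace.exists_placesOver_smul_ne_of_not_isField E v c hc1 hsplit
  have hJw : IsUnit (placeForm (Matrix.reindex e e (JV ⊗ₖ JW F E a)) w.1) := isUnit_placeForm _ hJu w.1
  -- the local character of the centre: unitary and continuous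
  have hχu := norm_localCharOfCenter F E c (JW F E a) (JW_apply_ne_zero F E a) hχ₁n v
  have hχc := continuous_coe_localCharOfCenter F E c (JW F E a) (JW_apply_ne_zero F E a) hχ₁c v
  -- IV-3(a), a tree theorem: the model, at the section `𝓢.s v` (`𝓢.omegaLoc v = toRep ∘ 𝓢.s v` by `rfl`)
  obtain ⟨ν, χ', hνu, hνc, hχ'u, hχ'c, hiso⟩ :=
    splitPlace_chiCoinv_iso_parabolicIndGL_of_isIrreducible
      Zelevinsky1980.parabolicIndGL_detChar_unitary_isIrreducible_holds.{0} F E c hc1 n hn δ hcδ hδ d hd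
      (gram F e TV (TW F a)) (isSymm_gram F e hV (isSymm_TW F a)) (isUnit_det_gram F e hVd (isUnit_det_TW F a))
      (Matrix.reindex e e (JV ⊗ₖ JW F E a)) (reindex_kronecker_eq_gram_map F E e hJV (JW_eq F E a)) hJh v w hw hJw
      (Measure.pi fun _ : Fin n => μ') (𝓢.s v) (𝓢.proj_s v) (𝓢.smooth v) hL2 (JW F E a) (JW_apply_ne_zero F E a)
      (localCharOfCenter F E c (JW F E a) (JW_apply_ne_zero F E a) χ₁ v) hχu hχc
  -- IV-3(b), a tree theorem: the induced representation is irreducible; and it is admissible (Bernstein–Zelevinsky)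
  have hPirr := Zelevinsky1980.parabolicIndGL_detChar_unitary_isIrreducible_holds.{0} (w.1.adicCompletion E) n ν
    (χ' * ν ^ (1 - (n : ℤ))) hνu hνc (norm_coe_mul_zpow' ν χ' hνu hχ'u _) (continuous_coe_mul_zpow' ν χ' hνc hχ'c _)
  have hPadm := Representation.isAdmissible_parabolicIndGL_holds (w.1.adicCompletion E) (Zelevinsky1980.lastBlockLabel n) _
    (SplitPlace.isAdmissible_trivial_twist_maxParabolicLeviChar (K := w.1.adicCompletion E) n ν χ' hνc hχ'c (1 - (n : ℤ)))
  -- transport back along the model and `localPiSplitEquiv`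
  exact SplitPlace.adjectives_of_areIsomorphicRep_comp_symm _ _ _ hiso hPirr hPadm

include hVd hχ₁n hχ₁c in
/-- **the local input at EVERY finite place, rank `n ≥ 2`**: irreducible-or-zero and admissible — non-split from [MVW IV.4] ★,
split from the `GL_n` model ★ under the unitarity `hL2` of `ω_v`. [cite: Liu2021, App. D Lemma D.1 (l. 5227), proof l. 5249–5266] -/
theorem isIrreducibleOrZero_and_isAdmissible_local (hn : 2 ≤ n)
    [MeasurableSpace (v.adicCompletion F)] [BorelSpace (v.adicCompletion F)]
    (μ' : Measure (v.adicCompletion F)) [μ'.IsAddHaarMeasure]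
    (hL2 : ¬ IsField (LocalRing E v) → (𝓢.omegaLoc v).IsL2Isometric (Measure.pi fun _ : Fin n => μ')) :
    IsIrreducibleOrZero (TwistedCoinv.rep
        (ρW := show Representation ℂ (localPi E c 1 (JW F E a) v) (SchwartzBruhat (Fin n → v.adicCompletion F)) from
          (𝓢.omegaLoc v).comp (localCenter E c n (Matrix.reindex e e (JV ⊗ₖ JW F E a)) (JW F E a) (JW_apply_ne_zero F E a) v))
        (localCharOfCenter F E c (JW F E a) (JW_apply_ne_zero F E a) χ₁ v) (𝓢.omegaLoc v)
        (fun g z => (show Commute g (localCenter E c n (Matrix.reindex e e (JV ⊗ₖ JW F E a)) (JW F E a) (JW_apply_ne_zero F E a) v z) from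
        localCenter_comm E c n (Matrix.reindex e e (JV ⊗ₖ JW F E a)) (JW F E a) (JW_apply_ne_zero F E a) v z g).map (𝓢.omegaLoc v))) ∧
      (TwistedCoinv.rep
        (ρW := show Representation ℂ (localPi E c 1 (JW F E a) v) (SchwartzBruhat (Fin n → v.adicCompletion F)) from
          (𝓢.omegaLoc v).comp (localCenter E c n (Matrix.reindex e e (JV ⊗ₖ JW F E a)) (JW F E a) (JW_apply_ne_zero F E a) v))
        (localCharOfCenter F E c (JW F E a) (JW_apply_ne_zero F E a) χ₁ v) (𝓢.omegaLoc v)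
        (fun g z => (show Commute g (localCenter E c n (Matrix.reindex e e (JV ⊗ₖ JW F E a)) (JW F E a) (JW_apply_ne_zero F E a) v z) from
        localCenter_comm E c n (Matrix.reindex e e (JV ⊗ₖ JW F E a)) (JW F E a) (JW_apply_ne_zero F E a) v z g).map (𝓢.omegaLoc v))).IsAdmissible := by
  by_cases hf : IsField (LocalRing E v)
  · exact isIrreducibleOrZero_and_isAdmissible_local_of_isField F E c N e JV hcδ hδ hd hV hVd hJV a 𝓢 χ₁ hχ₁n hχ₁c v hf
  · obtain ⟨h1, h2, -⟩ := splitPlace_irreducibleOrZero_and_isAdmissible_of_two_le F E c N e JV hcδ hδ hd hV hVd hJV a 𝓢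
      χ₁ hχ₁n hχ₁c v hn μ' hf (hL2 hf)
    exact ⟨h1, h2⟩

include hVd in
/-- **`ω(μ, ε, χ)` read on the place-assembled side is IRREDUCIBLE OR ZERO at every rank `n ≥ 1`** — for ANY family `𝓢` of
local splittings of `U(J_V ⊗ (a))` and any automorphic `χ ∈ Chi`, GIVEN the local inputs place by place (`hloc`: every local
central `χ_v`-quotient irreducible-or-zero and admissible — §3 supplies them at `n ≥ 2` under unitarity at the split places):
the `U(J_V)(𝔸_f)`-action on the maximal quotient of `Ω = ⊗'_v ω_v` where the centre acts by `χ` is irreducible or zero (§2;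
survival clause = ★ `survival_atLine`; `χ` continuous).
[cite: Liu2021, Def. 4.11 (l. 2090–2096), App. D §D.1 Steps 1∕2∕3 (l. 5217∕5219∕5221), Lemma D.1 (l. 5227; (1) l. 5229); Flath1979, Theorem 2 / Example 2] -/
theorem omega_center_isIrreducibleOrZero_atLine [NeZero n] (χ : Chi F E c)
    (hloc : ∀ v, IsIrreducibleOrZero (TwistedCoinv.rep
        (ρW := show Representation ℂ (localPi E c 1 (JW F E a) v) (SchwartzBruhat (Fin n → v.adicCompletion F)) from
          (𝓢.omegaLoc v).comp (localCenter E c n (Matrix.reindex e e (JV ⊗ₖ JW F E a)) (JW F E a) (JW_apply_ne_zero F E a) v))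
        (localCharOfCenter F E c (JW F E a) (JW_apply_ne_zero F E a) χ.1 v) (𝓢.omegaLoc v)
        (fun g z => (show Commute g (localCenter E c n (Matrix.reindex e e (JV ⊗ₖ JW F E a)) (JW F E a) (JW_apply_ne_zero F E a) v z) from
        localCenter_comm E c n (Matrix.reindex e e (JV ⊗ₖ JW F E a)) (JW F E a) (JW_apply_ne_zero F E a) v z g).map (𝓢.omegaLoc v))) ∧
      (TwistedCoinv.rep
        (ρW := show Representation ℂ (localPi E c 1 (JW F E a) v) (SchwartzBruhat (Fin n → v.adicCompletion F)) from
          (𝓢.omegaLoc v).comp (localCenter E c n (Matrix.reindex e e (JV ⊗ₖ JW F E a)) (JW F E a) (JW_apply_ne_zero F E a) v))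
        (localCharOfCenter F E c (JW F E a) (JW_apply_ne_zero F E a) χ.1 v) (𝓢.omegaLoc v)
        (fun g z => (show Commute g (localCenter E c n (Matrix.reindex e e (JV ⊗ₖ JW F E a)) (JW F E a) (JW_apply_ne_zero F E a) v z) from
        localCenter_comm E c n (Matrix.reindex e e (JV ⊗ₖ JW F E a)) (JW F E a) (JW_apply_ne_zero F E a) v z g).map (𝓢.omegaLoc v))).IsAdmissible) :
    IsIrreducibleOrZero (TwistedCoinv.rep χ.1
      (show Representation ℂ (finAdelic F E c N JV) _ from
        𝓢.Omega.comp ((finPairEmb F E c N 1 e JV (JW F E a)).comp (MonoidHom.inl _ _)))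
      (commute_omega_finPairEmb_finAdelicCenter F E c N e JV (JW F E a) hcδ hδ hd hV (isSymm_TW F a) hJV (JW_eq F E a) 𝓢)) := by
  obtain ⟨S₁, hS₁⟩ := survival_atLine F E c N e JV hcδ hδ hd hV hVd hJV a χ 𝓢
  exact omega_center_isIrreducibleOrZero_of_local F E c N e JV (JW F E a) hcδ hδ hd hV (isSymm_TW F a) hJV (JW_eq F E a)
    (JW_apply_ne_zero F E a) 𝓢 χ.2.1 hS₁ (fun v => (hloc v).1) (fun v => (hloc v).2)

end Local

/-! ## §4 HEAD: `ω(μ, ε, χ)` at THE χ-attached splitting is irreducible or zero, every rank `n ≥ 2` -/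

section Head

variable (L : Type) [Field L] [NumberField L] [IsCMField L]
variable {N' n' : ℕ} (e₁ : Fin N' × Fin 1 ≃ Fin n') (hn' : 2 ≤ n')
  (dV₁ : Fin N' → L) (hdV₁ : ∀ i, IsCMField.complexConj L (dV₁ i) = dV₁ i) (hdV₁0 : ∀ i, dV₁ i ≠ 0)
  (θ : HeckeCharacter L) (hθu : θ.IsUnitary) (hθs : IsSplittingChar L 1 θ)
  (a : (Fp L)ˣ) (χ : Chi (Fp L) L (IsCMField.complexConj L))

include hn' in
/-- **[Liu2021, Def. 4.11]'s `ω(μ, ε, χ)` AT THE χ-ATTACHED SPLITTING `chiSplittingLine θ` IS IRREDUCIBLE OR ZERO, every rank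
`n ≥ 2`.**  For a CM field `L`, a real diagonal Gram matrix `diag dV₁` of rank `N'`, a unitary Hecke character `θ` with the
splitting property (`IsSplittingChar L 1 θ` — [Liu2021, App. D Step 2]'s `μ`, the cell's `galConj μ`), any line `⟨a⟩` and any
automorphic `χ`: the `U(diag dV₁)(𝔸_{L⁺,f})`-representation `rhoVAtLine … (fun b => isCompatible_chiSplittingLine …) a χ` on the
`χ_W`-coinvariants of the finite Weil representation is irreducible or zero.  PROOF: ★
`rhoVAtLine_chiSplittingLine_areIsomorphicRep_omega_center` (twist-free comparison with the central `χ`-quotient of the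
place-assembled `Ω` of the undoubled family `𝓢_θ = congrW … (undoubledSplittings … θ (borelPlaceMeasure L) (cmFinLocalFamily …))`),
`omega_center_isIrreducibleOrZero_atLine` at `𝓢_θ` with the unitarity ★
`isL2Isometric_omegaLoc_congrW_undoubledSplittings_cmFinLocalFamily`, and `isIrreducibleOrZero_iff_of_areIsomorphicRep`.
At `N' = 2` zero DOES occur ([Liu2021, App. D Lem. D.1 (1)]): this, not `IsIrreducible`, is the true statement.
[cite: Liu2021, Def. 4.11 (l. 2090–2096), App. D §D.1 Steps 1∕2∕3 (l. 5217∕5219∕5221), Lemma D.1 (l. 5227; (1) l. 5229); GelbartRogawski1991, §3.1 Prop. 3.1.1 p. 455, Remark p. 457 L4–13; Flath1979, Theorem 2 / Example 2] -/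
theorem isIrreducibleOrZero_rhoVAtLine_chiSplittingLine :
    IsIrreducibleOrZero
      (rhoVAtLine (Fp L) L (IsCMField.complexConj L) N' e₁ (Matrix.diagonal dV₁) (complexConj_imagUnit L)
        (imagUnit_ne_zero L) (imagUnit_mul_self L) (realDiagonal_isSymm L dV₁ hdV₁) (isUnit_det_realDiagonal L dV₁ hdV₁ hdV₁0)
        (realDiagonal_map L dV₁ hdV₁).symm
        (fun b => isCompatible_chiSplittingLine L e₁ dV₁ hdV₁ hdV₁0 θ hθu hθs (TW (Fp L) b) (isSymm_TW (Fp L) b)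
          (isUnit_det_TW (Fp L) b) (JW (Fp L) L b) (JW_eq (Fp L) L b)) a χ) := by
  refine (isIrreducibleOrZero_iff_of_areIsomorphicRep
    (rhoVAtLine_chiSplittingLine_areIsomorphicRep_omega_center L e₁ dV₁ hdV₁ hdV₁0 θ hθu hθs a χ (borelPlaceMeasure L)
      (cmFinLocalFamily L e₁ dV₁ hdV₁ hdV₁0 (lineW L (TW (Fp L) a)) (complexConj_lineW L (TW (Fp L) a))
        (lineW_ne_zero L (TW (Fp L) a) (isUnit_det_TW (Fp L) a)) θ hθs (borelPlaceMeasure L)))).2 ?_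
  haveI : NeZero n' := ⟨by omega⟩
  refine omega_center_isIrreducibleOrZero_atLine (Fp L) L (IsCMField.complexConj L) N' e₁ (Matrix.diagonal dV₁)
    (complexConj_imagUnit L) (imagUnit_ne_zero L) (imagUnit_mul_self L) (realDiagonal_isSymm L dV₁ hdV₁)
    (isUnit_det_realDiagonal L dV₁ hdV₁ hdV₁0) (realDiagonal_map L dV₁ hdV₁).symm a _ χ fun v => ?_
  letI := (borelPlaceMeasure L v).mS; haveI := (borelPlaceMeasure L v).isBorel; haveI := (borelPlaceMeasure L v).isHaar
  exact isIrreducibleOrZero_and_isAdmissible_local (Fp L) L (IsCMField.complexConj L) N' e₁ (Matrix.diagonal dV₁)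
    (complexConj_imagUnit L) (imagUnit_ne_zero L) (imagUnit_mul_self L) (realDiagonal_isSymm L dV₁ hdV₁)
    (isUnit_det_realDiagonal L dV₁ hdV₁ hdV₁0) (realDiagonal_map L dV₁ hdV₁).symm a _ χ.1
    (norm_chi_eq_one (Fp L) L (IsCMField.complexConj L) (Algebra.IsQuadraticExtension.finrank_eq_two (Fp L) L)
      (UnitaryGroup.algEquiv_ne_one_of_apply_eq_neg (Fp L) L (IsCMField.complexConj L) (complexConj_imagUnit L)
        (imagUnit_ne_zero L)) χ)
    χ.2.1 v hn' (borelPlaceMeasure L v).μ fun _ =>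
      isL2Isometric_omegaLoc_congrW_undoubledSplittings_cmFinLocalFamily L e₁ dV₁ hdV₁ hdV₁0 (lineW L (TW (Fp L) a))
        (complexConj_lineW L (TW (Fp L) a)) (lineW_ne_zero L (TW (Fp L) a) (isUnit_det_TW (Fp L) a)) θ hθs
        (borelPlaceMeasure L) v hθu (realDiagonal_lineW L (TW (Fp L) a)) (diagonal_lineW L (TW (Fp L) a) (JW_eq (Fp L) L a))
        (isSymm_TW (Fp L) a) (JW_eq (Fp L) L a) (borelPlaceMeasure L v).μ

include hn' in
/-- **the same through any SURJECTIVE change of group** `φ : G →* U(diag dV₁)(𝔸_{L⁺,f})` — e.g. the rational frame isomorphism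
`(finAdelicCongr … g⋆ ht hg).symm` of the d6 line's registered carrier `ω⋆` (`IsIrreducibleOrZero (ω ∘ φ) ↔ IsIrreducibleOrZero ω`,
`isIrreducibleOrZero_comp_iff_of_surjective`). [cite: Liu2021, Def. 4.11 (l. 2090–2096), App. D Lemma D.1 (l. 5227; (1) l. 5229)] -/
theorem isIrreducibleOrZero_rhoVAtLine_chiSplittingLine_comp_of_surjective {G : Type} [Group G]
    (φ : G →* UnitaryGroup.finAdelic (Fp L) L (IsCMField.complexConj L) N' (Matrix.diagonal dV₁)) (hφ : Function.Surjective φ) :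
    IsIrreducibleOrZero
      ((rhoVAtLine (Fp L) L (IsCMField.complexConj L) N' e₁ (Matrix.diagonal dV₁) (complexConj_imagUnit L)
        (imagUnit_ne_zero L) (imagUnit_mul_self L) (realDiagonal_isSymm L dV₁ hdV₁) (isUnit_det_realDiagonal L dV₁ hdV₁ hdV₁0)
        (realDiagonal_map L dV₁ hdV₁).symm
        (fun b => isCompatible_chiSplittingLine L e₁ dV₁ hdV₁ hdV₁0 θ hθu hθs (TW (Fp L) b) (isSymm_TW (Fp L) b)
          (isUnit_det_TW (Fp L) b) (JW (Fp L) L b) (JW_eq (Fp L) L b)) a χ).comp φ) :=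
  (isIrreducibleOrZero_comp_iff_of_surjective _ φ hφ).2
    (isIrreducibleOrZero_rhoVAtLine_chiSplittingLine L e₁ hn' dV₁ hdV₁ hdV₁0 θ hθu hθs a χ)

end Head

end Literature.NumberTheory.Automorphic.Liu2021.Def411WeilCarriers

end
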